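import Summits.BirchSwinnertonDyer.BirchSwinnertonDyer.Theorems.ManinLocalTwoThreeEtaQuotientsOneTwentyEightA
import HarnessLib

/-!
# Level 128 (class `96c`), the `q`-toolkit IIa: `𝓧`, `η(r_𝓨)`, `A_j` as Euler products

Cell bsd-f2-manin, route `ManinLocalTwoThree` (crux C2 `ManinOddAtFour` stmt-22967: `2² ∣ 128`; `128 = 2⁷`, `v₂(N) = 7` — the deepest `2`-adic cell of the charter's "no semistable partner" range; genus `9`, four newforms `128a–d`), prover seat p3 gen 24.
Class `128c` (`128c1 = [0, -1, 0, 1, -1] : y² = x³ − x² + x − 1`, full rational `2`-torsion): `𝓧 = x` is the single `η`-quotient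
`etaQuotient 128 (expFn [(2, 2), (4, -3), (8, 1), (16, -1), (32, 3), (64, -2)])` (`Γ₀(128)`-invariant), `𝓨 = η(expFn [(2, 2), (4, -5), (8, 3), (16, 1), (32, 1), (64, -2)])` satisfies `x′ = −2πiφ·2𝓨`, `𝓨² = x³ − x² + x − 1`, and
`φ₁₂₈c = -4B1 − 2B2 + 4B3 + 2B4 + B5 + 2B6` on an-g51's `η`-basis `B₁…B₅` of the new part (cell HOME/an/g51 `newform-coords-D.out`; the PINNING `⇑D.f = φ₁₂₈c` is
NOT proved here).  THE E₂ ROAD (`EtaLogDerivativeForms`): `𝓧′ = (πi/12)G_𝓧𝓧`, `𝓨′ = (πi/12)G_𝓨𝓨`; `A_j = B_jη(r_𝓨)/𝓧`,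
`C_j^{(2)} = B_j𝓧²/η(r_𝓨)`, `C_j^{(1)} = B_j𝓧/η(r_𝓨)`, `C_j^{(0)} = B_j/η(r_𝓨)` are INDIVIDUALLY HOLOMORPHIC weight-`2` `η`-quotients on `Γ₀(128)`
(Ligozat orders, `decide`), so (I2a), (I2b) are LINEAR relations in `M₂(Γ₀(128))` settled by Sturm (`μ = 192`, `⌊2·192/12⌋ + 1 = 33`
coefficients).
Pure bookkeeping. Nothing here proves C2, Manin's conjecture or BSD; the other classes (`128b`, `128d` have no single η-quotient `y`) and the newform PINNING at `128` are separate; item 22967 stays OPEN. [cite: Ligozat1975, Ch. 3] [cite: CremonaAlgorithms1997, Table 1 (128c1)]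
-/

set_option autoImplicit false
-- lint-debt: the directory name repeats the summit name (sibling precedent `ManinLocalTwoThreeEtaQuotientsSeventyTwo.lean`)
set_option linter.dupNamespace false

noncomputable section

open Complex Filter Topology Set Asymptotics Polynomial EisensteinSeries
open UpperHalfPlane hiding I
open scoped Real Topology Manifold MatrixGroups ModularForm
open ModularForm CongruenceSubgroup
open Literature.NumberTheory.ModularForms
open Literature.NumberTheory.EllipticCurves Literature.NumberTheory.EllipticCurves.ModularForms

namespace Summit.BirchSwinnertonDyer.BirchSwinnertonDyer.Theorems.ManinLocalTwoThree.EtaQuotientsOneTwentyEightC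

open QRemainder EulerRemainders EtaQuotientsOneTwentyEightA 

/-- **`𝓧 = x`** of `X₀(96) → 96c1`. [folklore] -/
theorem X_eq (τ : ℍ) :
    etaQuotient 128 (expFn [(2, 2), (4, -3), (8, 1), (16, -1), (32, 3), (64, -2)]) τ
      = eulerFn 2 τ ^ 2 * eulerFn 8 τ * eulerFn 32 τ ^ 3 / (Function.Periodic.qParam 1 (τ : ℂ) ^ 2 * eulerFn 4 τ ^ 3 * eulerFn 16 τ * eulerFn 64 τ ^ 2) := by
  have hE4 := eulerFn_ne_zero (by norm_num : 0 < 4) τ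
  have hE16 := eulerFn_ne_zero (by norm_num : 0 < 16) τ
  have hE64 := eulerFn_ne_zero (by norm_num : 0 < 64) τ
  have hq := qParam_ne_zero τ
  rw [etaQuotient_eq_cexp_mul_prod, divisors_oneTwentyEight]
  have hsum : (∑ δ ∈ ({1, 2, 4, 8, 16, 32, 64, 128} : Finset ℕ), (δ : ℤ) * expFn [(2, 2), (4, -3), (8, 1), (16, -1), (32, 3), (64, -2)] δ)
      = (-(24 * 2 : ℕ) : ℤ) := by decide
  rw [hsum, cexp_neg_eq_inv_qParam_pow]
  rw [
    Finset.prod_insert (by decide), Finset.prod_insert (by decide), Finset.prod_insert (by decide), Finset.prod_insert (by decide), Finset.prod_insert (by decide), Finset.prod_insert (by decide), Finset.prod_insert (by decide), Finset.prod_singleton]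
  rw [show expFn [(2, 2), (4, -3), (8, 1), (16, -1), (32, 3), (64, -2)] 1 = 0 by decide, show expFn [(2, 2), (4, -3), (8, 1), (16, -1), (32, 3), (64, -2)] 2 = 2 by decide,
    show expFn [(2, 2), (4, -3), (8, 1), (16, -1), (32, 3), (64, -2)] 4 = (-3) by decide, show expFn [(2, 2), (4, -3), (8, 1), (16, -1), (32, 3), (64, -2)] 8 = 1 by decide,
    show expFn [(2, 2), (4, -3), (8, 1), (16, -1), (32, 3), (64, -2)] 16 = (-1) by decide, show expFn [(2, 2), (4, -3), (8, 1), (16, -1), (32, 3), (64, -2)] 32 = 3 by decide,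
    show expFn [(2, 2), (4, -3), (8, 1), (16, -1), (32, 3), (64, -2)] 64 = (-2) by decide, show expFn [(2, 2), (4, -3), (8, 1), (16, -1), (32, 3), (64, -2)] 128 = 0 by decide]
  simp only [zpow_neg, zpow_ofNat]
  field_simp

/-- **`η(r_𝓨)`** (`𝓨` up to sign). [folklore] -/
theorem Yeta_eq (τ : ℍ) :
    etaQuotient 128 (expFn [(2, 2), (4, -5), (8, 3), (16, 1), (32, 1), (64, -2)]) τ
      = eulerFn 2 τ ^ 2 * eulerFn 8 τ ^ 3 * eulerFn 16 τ * eulerFn 32 τ / (Function.Periodic.qParam 1 (τ : ℂ) ^ 3 * eulerFn 4 τ ^ 5 * eulerFn 64 τ ^ 2) := by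
  have hE4 := eulerFn_ne_zero (by norm_num : 0 < 4) τ
  have hE64 := eulerFn_ne_zero (by norm_num : 0 < 64) τ
  have hq := qParam_ne_zero τ
  rw [etaQuotient_eq_cexp_mul_prod, divisors_oneTwentyEight]
  have hsum : (∑ δ ∈ ({1, 2, 4, 8, 16, 32, 64, 128} : Finset ℕ), (δ : ℤ) * expFn [(2, 2), (4, -5), (8, 3), (16, 1), (32, 1), (64, -2)] δ)
      = (-(24 * 3 : ℕ) : ℤ) := by decide
  rw [hsum, cexp_neg_eq_inv_qParam_pow]
  rw [
    Finset.prod_insert (by decide), Finset.prod_insert (by decide), Finset.prod_insert (by decide), Finset.prod_insert (by decide), Finset.prod_insert (by decide), Finset.prod_insert (by decide), Finset.prod_insert (by decide), Finset.prod_singleton]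
  rw [show expFn [(2, 2), (4, -5), (8, 3), (16, 1), (32, 1), (64, -2)] 1 = 0 by decide, show expFn [(2, 2), (4, -5), (8, 3), (16, 1), (32, 1), (64, -2)] 2 = 2 by decide,
    show expFn [(2, 2), (4, -5), (8, 3), (16, 1), (32, 1), (64, -2)] 4 = (-5) by decide, show expFn [(2, 2), (4, -5), (8, 3), (16, 1), (32, 1), (64, -2)] 8 = 3 by decide,
    show expFn [(2, 2), (4, -5), (8, 3), (16, 1), (32, 1), (64, -2)] 16 = 1 by decide, show expFn [(2, 2), (4, -5), (8, 3), (16, 1), (32, 1), (64, -2)] 32 = 1 by decide,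
    show expFn [(2, 2), (4, -5), (8, 3), (16, 1), (32, 1), (64, -2)] 64 = (-2) by decide, show expFn [(2, 2), (4, -5), (8, 3), (16, 1), (32, 1), (64, -2)] 128 = 0 by decide]
  simp only [zpow_neg, zpow_ofNat]
  field_simp

end Summit.BirchSwinnertonDyer.BirchSwinnertonDyer.Theorems.ManinLocalTwoThree.EtaQuotientsOneTwentyEightC

end
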